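import Literature.MathematicalPhysics.QuantumFieldTheory.Balaban1983to89.B3WT224Instance

/-!
# `Balaban1983to89.B3WT226Pairings` — T. Bałaban, *(Higgs)₂,₃ quantum fields in a finite volume. III. Renormalization*,
# Commun. Math. Phys. **88** (1983) 411–445 [Balaban1983Higgs3], (2.26) p. 431: the three pairings of the LEFT member of (2.26)
# and the `A`-derivative of the (2.24)-pairing ON THE CONCRETE LATTICE MODEL (file 1/2 of R11 part 2a; file 2/2 =
# `…B3WT226Derivative`, the identity itself)

statement-level skeleton of published theorems with citation tags; proofs where landed; nothing here is a claim about the Yang–Mills mass gap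

PDF held: `paper:balaban1983-higgs-2-3-quantum-fields-finite-volume` (journal page = PDF page + 410); p. 431 read AS AN IMAGE on the
×2 render `run/shared/lean/pub/pub-balaban/b2b-balaban-ref1/pages/1983-cmp88-higgs23-III/1983-cmp88-higgs23-III-p021-x2.png`
(the text layer of (2.26) is unusable).  Page 431, verbatim: *"Taking F = 1, differentiating with respect to A and next taking
A = 0 and using the identity (2.25), we get*
  `∫dμ_{C^η_{M²}}(φ)[(−e_k⟨∂^ηφ, Aqφ⟩)(:⟨∂^ηφ, ∂^ηλqφ⟩:) − e_k⟨φ, A·∂^ηλq²φ⟩ − e_k⟨∂^ηφ, ηA∂^ηλq²φ⟩] = [four trace terms] = 0. (2.26)"*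
THIS FILE, for the lattice model of `…B3WT223Instance`/`…B3WT224Instance` (fields `φ : T^{(j)} → R^N`, `U(A) = exp(qηeA)` of B1
(1.7), weight `w = η^d`, lattice factor `c = η⁻¹`): the printed pairings `⟨∂^ηφ, Bqφ⟩` (`curJ`), `⟨φ, B·∂^ηλq²φ⟩` (`locQ`),
`⟨∂^ηφ, B∂^ηλq²φ⟩` (`derQ`) for a direction `B` of the vector field (print: `A`); the current `⟨D^η_Aφ, BqU(A)φ⟩` in a general
background (`pairJ`; the (2.24)-pairing `B3WT224Instance.pairDA` is its value on `B = ∂^ηλ`); the DERIVATIVES along the backgrounds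
`A = sB` — `d/ds ⟨φ,(−Δ^η_{sB}+M²)φ⟩ = 2cηe⟨D^η_{sB}φ, BqU(sB)φ⟩` (`hasDerivAt_quadForm_lin`, hence `hasDerivAt_weight_lin`) and
`d/ds ⟨D^η_{sB}φ, ∂^ηλqU(sB)φ⟩ = pairDAdot` (`hasDerivAt_pairDA_lin`) — COMPUTED from `d/ds U(sg) = ηeg·qU(sg)` (`hasDerivAt_U_lin`);
the split **`pairDAdot|_{A=0} = −cηe⟨φ, B·∂^ηλq²φ⟩ − ηe⟨∂^ηφ, B∂^ηλq²φ⟩`** (`pairDAdot_zero`) reproducing the second and third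
printed terms WITH THEIR SIGNS and the explicit `η` when `φ` is read at the base point `b₋` of the bond (only `q* = −q`, B1 p. 605,
is used: `inner_q_left`); and the uniform bounds / continuity feeding the dominated differentiation of file 2/2.
Phase-2 RESERVE R11 (part 2a) of `PHASE2-TARGETS.md` §G.3; cell `lit-balaban`, seat p39 (gen 2, unit `lit-balaban-p39`), HOME
`run/shared/lean/pub/lit-balaban/`.  Nothing beyond these lattice identities is asserted; no new `Prop` is introduced.
-/

noncomputable section

open scoped BigOperators InnerProductSpace

namespace Literature.MathematicalPhysics.QuantumFieldTheory.Balaban1983to89.B3WT226Pairings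

open _root_.MeasureTheory
open LatticeFieldCalculus B3WT223Instance B3WT224Instance

variable {P : Params} {j N : ℕ} (C : HiggsLattice.ChargeData N) (η w c M2 : ℝ)

/-! ## §1 Antisymmetry of the charge matrix (B1 p. 605) -/

/-- *"Antisymmetry of q"* (B1 p. 605, `q* = −q`): `⟪qu, v⟫ = −⟪u, qv⟫`. [cite: Balaban1982Higgs1, (1.7) p.605] -/
theorem inner_q_left (u v : EuclideanSpace ℝ (Fin N)) : ⟪C.q u, v⟫_ℝ = -⟪u, C.q v⟫_ℝ := by
  have h : ContinuousLinearMap.adjoint C.q = -C.q := by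
    rw [← ContinuousLinearMap.star_eq_adjoint]
    exact C.q_skew
  rw [← ContinuousLinearMap.adjoint_inner_right, h, neg_apply, inner_neg_right]

/-- `⟪u, qu⟫ = 0` (antisymmetry of `q`; p. 434: a loop with one `q` vanishes). [cite: Balaban1982Higgs1, (1.7) p.605] -/
theorem inner_q_self (u : EuclideanSpace ℝ (Fin N)) : ⟪u, C.q u⟫_ℝ = 0 := by
  have h1 := inner_q_left C u u
  have h2 := real_inner_comm (C.q u) u
  linarith

/-- `|qv|² = −⟪v, q²v⟫` (antisymmetry of `q`). [cite: Balaban1982Higgs1, (1.7) p.605] -/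
theorem inner_q_q_self (v : EuclideanSpace ℝ (Fin N)) : ⟪C.q v, C.q v⟫_ℝ = -⟪v, C.q (C.q v)⟫_ℝ :=
  inner_q_left C v (C.q v)

/-- `q²` is symmetric: `⟪v, q²u⟫ = ⟪u, q²v⟫`. [cite: Balaban1982Higgs1, (1.7) p.605] -/
theorem inner_qq_comm (u v : EuclideanSpace ℝ (Fin N)) : ⟪v, C.q (C.q u)⟫_ℝ = ⟪u, C.q (C.q v)⟫_ℝ := by
  have h1 := inner_q_left C v (C.q u)
  have h2 := inner_q_left C u (C.q v)
  have h3 := real_inner_comm (C.q u) (C.q v)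
  linarith

/-! ## §2 The pairings printed in (2.26) and the current along a direction `B` -/

/-- `⟨∂^ηφ, Bqφ⟩ := Σ_b η^d ⟪(∂^ηφ)(b), B_b·qφ(b₊)⟫` — the first pairing of (2.26) (print: `⟨∂^ηφ, Aqφ⟩`).
[cite: Balaban1983Higgs3, (2.26) p.431] -/
def curJ (B : VecField P j ℝ) (φ : Cfg P j N) : ℝ := ∑ b : PBond P j, w * ⟪grad c φ b, (B b) • C.q (φ b.tgt)⟫_ℝ

/-- `⟨φ, B·∂^ηλq²φ⟩ := Σ_b η^d B_b(∂^ηλ)(b)⟪φ(b₋), q²φ(b₋)⟫` — the second pairing of (2.26) (a bond-local function `B·∂^ηλ` against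
the undifferentiated field, read at the base point `b₋`). [cite: Balaban1983Higgs3, (2.26) p.431] -/
def locQ (B : VecField P j ℝ) (lam : Site P j → ℝ) (φ : Cfg P j N) : ℝ :=
  ∑ b : PBond P j, w * (B b * grad c lam b * ⟪φ b.src, C.q (C.q (φ b.src))⟫_ℝ)

/-- `⟨∂^ηφ, B∂^ηλq²φ⟩ := Σ_b η^d B_b(∂^ηλ)(b)⟪(∂^ηφ)(b), q²φ(b₋)⟫` — the third pairing of (2.26) (the print carries the extra
factor `η` outside: `⟨∂^ηφ, ηA∂^ηλq²φ⟩`). [cite: Balaban1983Higgs3, (2.26) p.431] -/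
def derQ (B : VecField P j ℝ) (lam : Site P j → ℝ) (φ : Cfg P j N) : ℝ :=
  ∑ b : PBond P j, w * (B b * grad c lam b * ⟪grad c φ b, C.q (C.q (φ b.src))⟫_ℝ)

/-- the current in a general background, `⟨D^η_Aφ, BqU(A)φ⟩ := Σ_b η^d ⟪(D^η_Aφ)(b), B_b·qU(A_b)φ(b₊)⟫`; the pairing of (2.24) is
its value on `B = ∂^ηλ` (`pairDA_eq_pairJ`). [cite: Balaban1983Higgs3, (2.24) p.430] -/
def pairJ (A B : VecField P j ℝ) (φ : Cfg P j N) : ℝ :=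
  ∑ b : PBond P j, w * ⟪covDerivScalar c (C.Urep η) A φ b, (B b) • C.q (C.U η (A b) (φ b.tgt))⟫_ℝ

/-- `⟨D^η_Aφ, ∂^ηλqφ⟩ = ⟨D^η_Aφ, (∂^ηλ)qU(A)φ⟩`. [cite: Balaban1983Higgs3, (2.24) p.430] -/
theorem pairDA_eq_pairJ (A : VecField P j ℝ) (lam : Site P j → ℝ) (φ : Cfg P j N) :
    pairDA C η w c A lam φ = pairJ C η w c A (grad c lam) φ := rfl

/-- `(1·v) = v` for the identity operator (plumbing). [folklore] -/
private theorem one_apply' (v : EuclideanSpace ℝ (Fin N)) :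
    (1 : EuclideanSpace ℝ (Fin N) →L[ℝ] EuclideanSpace ℝ (Fin N)) v = v := rfl

/-- at `A = 0`: `⟨D^η_0φ, BqU(0)φ⟩ = ⟨∂^ηφ, Bqφ⟩` (`U(0) = 1`, `D_0 = ∂`). [cite: Balaban1983Higgs3, (2.26) p.431] -/
theorem pairJ_zero (B : VecField P j ℝ) (φ : Cfg P j N) : pairJ C η w c (0 : VecField P j ℝ) B φ = curJ C w c B φ := by
  unfold pairJ curJ
  refine Finset.sum_congr rfl fun b _ => ?_
  have h0 : covDerivScalar c (C.Urep η) (0 : VecField P j ℝ) φ = grad c φ := covDerivScalar_Urep_zero C η c φ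
  rw [h0, Pi.zero_apply, HiggsLattice.ChargeData.U_zero, one_apply']

/-- the `s`-derivative of `⟨D^η_{A}φ, ∂^ηλqU(A)φ⟩` along `A + sB`, evaluated at the background `A`: the `U`'s in BOTH slots are
differentiated (`d/ds U(A_b+sB_b) = ηeB_b·qU(…)`). [cite: Balaban1983Higgs3, (2.26) p.431] -/
def pairDAdot (A B : VecField P j ℝ) (lam : Site P j → ℝ) (φ : Cfg P j N) : ℝ :=
  ∑ b : PBond P j, w *
    (⟪covDerivScalar c (C.Urep η) A φ b, (grad c lam b) • C.q ((η * C.e * B b) • C.q (C.U η (A b) (φ b.tgt)))⟫_ℝ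
      + ⟪c • ((η * C.e * B b) • C.q (C.U η (A b) (φ b.tgt))), (grad c lam b) • C.q (C.U η (A b) (φ b.tgt))⟫_ℝ)

/-- **the printed split of the derivative term**: at `A = 0`,
`d/ds⟨D^η_{sB}φ, ∂^ηλqU(sB)φ⟩|₀ = −cηe⟨φ, B·∂^ηλq²φ⟩ − ηe⟨∂^ηφ, B∂^ηλq²φ⟩` (with `φ(b₊) = φ(b₋) + c⁻¹(∂^ηφ)(b)` expanded at the
base point; only `q* = −q` is used). [cite: Balaban1983Higgs3, (2.26) p.431] -/
theorem pairDAdot_zero (B : VecField P j ℝ) (lam : Site P j → ℝ) (φ : Cfg P j N) :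
    pairDAdot C η w c (0 : VecField P j ℝ) B lam φ =
      -(c * η * C.e) * locQ C w c B lam φ - η * C.e * derQ C w c B lam φ := by
  unfold pairDAdot locQ derQ
  rw [Finset.mul_sum, Finset.mul_sum, ← Finset.sum_sub_distrib]
  refine Finset.sum_congr rfl fun b _ => ?_
  have h0 : covDerivScalar c (C.Urep η) (0 : VecField P j ℝ) φ = grad c φ := covDerivScalar_Urep_zero C η c φ
  rw [h0, Pi.zero_apply, HiggsLattice.ChargeData.U_zero, one_apply']
  have hg : grad c φ b = c • (φ b.tgt - φ b.src) := rfl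
  rw [hg]
  have h1 := inner_q_q_self C (φ b.tgt)
  have h2 := inner_qq_comm C (φ b.tgt) (φ b.src)
  simp only [map_smul, real_inner_smul_left, real_inner_smul_right, inner_sub_left]
  rw [h1, h2]
  ring

/-! ## §3 Derivatives along the backgrounds `A = sB` -/

/-- `d/ds U(sg)v = ηeg·qU(sg)v` for `U(a) = exp(qηea)` (B1 (1.7)). [cite: Balaban1982Higgs1, (1.7) p.605] -/
theorem hasDerivAt_U_lin (g : ℝ) (v : EuclideanSpace ℝ (Fin N)) (t : ℝ) :
    HasDerivAt (fun s : ℝ => C.U η (s * g) v) ((η * C.e * g) • C.q (C.U η (t * g) v)) t := by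
  have hθ : HasDerivAt (fun s : ℝ => η * C.e * (s * g)) (η * C.e * g) t := by
    refine (((hasDerivAt_id t).mul_const g).const_mul (η * C.e)).congr_deriv ?_
    ring
  have hexp : HasDerivAt (fun u : ℝ => NormedSpace.exp (u • C.q))
      (C.q * NormedSpace.exp ((η * C.e * (t * g)) • C.q)) (η * C.e * (t * g)) :=
    hasDerivAt_exp_smul_const' C.q _
  have hcomp := hexp.scomp t hθ
  have happ := ((ContinuousLinearMap.apply ℝ (EuclideanSpace ℝ (Fin N)) v).hasFDerivAt).comp_hasDerivAt t hcomp
  exact happ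

/-- the covariant derivative in the background `sB`, unfolded. [cite: Balaban1983Higgs3, (2.24) p.430] -/
theorem covDerivScalar_lin (B : VecField P j ℝ) (φ : Cfg P j N) (b : PBond P j) (s : ℝ) :
    covDerivScalar c (C.Urep η) (s • B) φ b = c • (C.U η (s * B b) (φ b.tgt) - φ b.src) := by
  simp only [covDerivScalar, HiggsLattice.ChargeData.Urep_apply, Pi.smul_apply, smul_eq_mul]

/-- `d/ds (D^η_{sB}φ)(b) = c·ηeB_b·qU(sB_b)φ(b₊)`. [cite: Balaban1983Higgs3, (2.26) p.431] -/
theorem hasDerivAt_covDerivScalar_lin (B : VecField P j ℝ) (φ : Cfg P j N) (b : PBond P j) (t : ℝ) :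
    HasDerivAt (fun s : ℝ => covDerivScalar c (C.Urep η) (s • B) φ b)
      (c • ((η * C.e * B b) • C.q (C.U η (t * B b) (φ b.tgt)))) t := by
  have h := ((hasDerivAt_U_lin C η (B b) (φ b.tgt) t).sub_const (φ b.src)).const_smul c
  exact h.congr_of_eventuallyEq (Filter.Eventually.of_forall fun s => covDerivScalar_lin C η c B φ b s)

/-- the current in the background `tB`, unfolded. [cite: Balaban1983Higgs3, (2.26) p.431] -/
theorem pairJ_lin (B : VecField P j ℝ) (φ : Cfg P j N) (t : ℝ) :
    pairJ C η w c (t • B) B φ =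
      ∑ b : PBond P j, w * ⟪covDerivScalar c (C.Urep η) (t • B) φ b, (B b) • C.q (C.U η (t * B b) (φ b.tgt))⟫_ℝ := by
  unfold pairJ
  simp only [Pi.smul_apply, smul_eq_mul]

/-- **`d/ds ⟨φ,(−Δ^η_{sB}+M²)φ⟩ = 2cηe·⟨D^η_{sB}φ, BqU(sB)φ⟩`** — the differentiation *"with respect to A"* of the exponent.
[cite: Balaban1983Higgs3, (2.26) p.431] -/
theorem hasDerivAt_quadForm_lin (B : VecField P j ℝ) (φ : Cfg P j N) (t : ℝ) :
    HasDerivAt (fun s : ℝ => quadForm C η w c M2 (s • B) φ) ((2 * (c * η * C.e)) * pairJ C η w c (t • B) B φ) t := by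
  unfold quadForm covLaplaceForm
  have hsum : HasDerivAt (fun s : ℝ => ∑ b : PBond P j, w * ‖covDerivScalar c (C.Urep η) (s • B) φ b‖ ^ 2)
      (∑ b : PBond P j, w * (2 * ⟪covDerivScalar c (C.Urep η) (t • B) φ b,
        c • ((η * C.e * B b) • C.q (C.U η (t * B b) (φ b.tgt)))⟫_ℝ)) t :=
    HasDerivAt.fun_sum fun b _ => (hasDerivAt_covDerivScalar_lin C η c B φ b t).norm_sq.const_mul w
  refine (hsum.add_const (M2 * massForm w φ)).congr_deriv ?_
  rw [pairJ_lin, Finset.mul_sum]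
  refine Finset.sum_congr rfl fun b _ => ?_
  rw [real_inner_smul_right, real_inner_smul_right, real_inner_smul_right]
  ring

/-- `d/ds exp[−½⟨φ,(−Δ^η_{sB}+M²)φ⟩] = −cηe·exp[…]·⟨D^η_{sB}φ, BqU(sB)φ⟩` — the source of the first term of (2.26).
[cite: Balaban1983Higgs3, (2.26) p.431] -/
theorem hasDerivAt_weight_lin (B : VecField P j ℝ) (φ : Cfg P j N) (t : ℝ) :
    HasDerivAt (fun s : ℝ => weight C η w c M2 (s • B) φ)
      (-(c * η * C.e) * (weight C η w c M2 (t • B) φ * pairJ C η w c (t • B) B φ)) t := by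
  unfold weight
  refine (((hasDerivAt_quadForm_lin C η w c M2 B φ t).const_mul (-(1 / 2 : ℝ))).exp).congr_deriv ?_
  ring

/-- `d/ds (∂^ηλ)(b)·qU(sB_b)φ(b₊) = (∂^ηλ)(b)·q(ηeB_b·qU(sB_b)φ(b₊))` — the second slot of the pairing is differentiated too.
[cite: Balaban1983Higgs3, (2.26) p.431] -/
theorem hasDerivAt_qU_lin (B : VecField P j ℝ) (lam : Site P j → ℝ) (φ : Cfg P j N) (b : PBond P j) (t : ℝ) :
    HasDerivAt (fun s : ℝ => (grad c lam b) • C.q (C.U η (s * B b) (φ b.tgt)))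
      ((grad c lam b) • C.q ((η * C.e * B b) • C.q (C.U η (t * B b) (φ b.tgt)))) t := by
  have h := ((C.q.hasFDerivAt).comp_hasDerivAt t (hasDerivAt_U_lin C η (B b) (φ b.tgt) t)).const_smul (grad c lam b)
  exact h

/-- the pairing of (2.24) in the background `sB`, unfolded. [cite: Balaban1983Higgs3, (2.26) p.431] -/
theorem pairDA_lin (B : VecField P j ℝ) (lam : Site P j → ℝ) (φ : Cfg P j N) (s : ℝ) :
    pairDA C η w c (s • B) lam φ =
      ∑ b : PBond P j, w * ⟪covDerivScalar c (C.Urep η) (s • B) φ b, (grad c lam b) • C.q (C.U η (s * B b) (φ b.tgt))⟫_ℝ := by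
  unfold pairDA
  simp only [Pi.smul_apply, smul_eq_mul]

/-- the derivative term in the background `tB`, unfolded. [cite: Balaban1983Higgs3, (2.26) p.431] -/
theorem pairDAdot_lin (B : VecField P j ℝ) (lam : Site P j → ℝ) (φ : Cfg P j N) (t : ℝ) :
    pairDAdot C η w c (t • B) B lam φ = ∑ b : PBond P j, w *
      (⟪covDerivScalar c (C.Urep η) (t • B) φ b, (grad c lam b) • C.q ((η * C.e * B b) • C.q (C.U η (t * B b) (φ b.tgt)))⟫_ℝ
        + ⟪c • ((η * C.e * B b) • C.q (C.U η (t * B b) (φ b.tgt))), (grad c lam b) • C.q (C.U η (t * B b) (φ b.tgt))⟫_ℝ) := by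
  unfold pairDAdot
  simp only [Pi.smul_apply, smul_eq_mul]

/-- **`d/ds ⟨D^η_{sB}φ, ∂^ηλqU(sB)φ⟩`** exists and is `pairDAdot` (product rule for the inner product, bondwise).
[cite: Balaban1983Higgs3, (2.26) p.431] -/
theorem hasDerivAt_pairDA_lin (B : VecField P j ℝ) (lam : Site P j → ℝ) (φ : Cfg P j N) (t : ℝ) :
    HasDerivAt (fun s : ℝ => pairDA C η w c (s • B) lam φ) (pairDAdot C η w c (t • B) B lam φ) t := by
  have hsum : HasDerivAt (fun s : ℝ => ∑ b : PBond P j, w * ⟪covDerivScalar c (C.Urep η) (s • B) φ b,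
      (grad c lam b) • C.q (C.U η (s * B b) (φ b.tgt))⟫_ℝ)
      (∑ b : PBond P j, w *
        (⟪covDerivScalar c (C.Urep η) (t • B) φ b, (grad c lam b) • C.q ((η * C.e * B b) • C.q (C.U η (t * B b) (φ b.tgt)))⟫_ℝ
          + ⟪c • ((η * C.e * B b) • C.q (C.U η (t * B b) (φ b.tgt))), (grad c lam b) • C.q (C.U η (t * B b) (φ b.tgt))⟫_ℝ)) t :=
    HasDerivAt.fun_sum fun b _ =>
      ((hasDerivAt_covDerivScalar_lin C η c B φ b t).inner ℝ (hasDerivAt_qU_lin C η c B lam φ b t)).const_mul w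
  rw [pairDAdot_lin]
  exact hsum.congr_of_eventuallyEq (Filter.Eventually.of_forall fun s => pairDA_lin C η w c B lam φ s)

/-! ## §4 Bounds and continuity (for the dominated differentiation) -/

/-- `|qx| ≤ |x|` (B1 p. 605: `|q| ≤ 1`). [cite: Balaban1982Higgs1, (1.7) p.605] -/
theorem norm_q_apply_le (x : EuclideanSpace ℝ (Fin N)) : ‖C.q x‖ ≤ ‖x‖ :=
  calc ‖C.q x‖ ≤ ‖C.q‖ * ‖x‖ := C.q.le_opNorm x
    _ ≤ 1 * ‖x‖ := mul_le_mul_of_nonneg_right C.norm_q_le (norm_nonneg _)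
    _ = ‖x‖ := one_mul _

/-- `|U(a)v| = |v|` (`U` unitary, B1 p. 605). [cite: Balaban1982Higgs1, (1.7) p.605] -/
theorem norm_U_apply (a : ℝ) (v : EuclideanSpace ℝ (Fin N)) : ‖C.U η a v‖ = ‖v‖ :=
  ContinuousLinearMap.norm_map_of_mem_unitary (C.U_mem_unitary η a) v

/-- the constant `K(B) = Σ_b |η^d|·2|c|·|B_b|` of `|⟨D^η_Aφ, BqU(A)φ⟩| ≤ K(B)·sup|φ|²`. [cite: Balaban1983Higgs3, (2.26) p.431] -/
def pairBoundV (B : VecField P j ℝ) : ℝ := ∑ b : PBond P j, |w| * (2 * |c| * |B b|)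

/-- `K(B) ≥ 0`. [cite: Balaban1983Higgs3, (2.26) p.431] -/
theorem pairBoundV_nonneg (B : VecField P j ℝ) : 0 ≤ pairBoundV w c B := Finset.sum_nonneg fun _ _ => by positivity

/-- `|⟨D^η_Aφ, BqU(A)φ⟩| ≤ K(B)·sup|φ|²`, uniformly in the background. [cite: Balaban1983Higgs3, (2.26) p.431] -/
theorem abs_pairJ_le (A B : VecField P j ℝ) (φ : Cfg P j N) : |pairJ C η w c A B φ| ≤ pairBoundV w c B * ‖φ‖ ^ 2 := by
  unfold pairJ pairBoundV
  rw [Finset.sum_mul]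
  refine (Finset.abs_sum_le_sum_abs _ _).trans (Finset.sum_le_sum fun b _ => ?_)
  rw [abs_mul]
  have h1 := abs_real_inner_le_norm (covDerivScalar c (C.Urep η) A φ b) ((B b) • C.q (C.U η (A b) (φ b.tgt)))
  have h2 := norm_covDerivScalar_le C η c A φ b
  have h3 : ‖(B b) • C.q (C.U η (A b) (φ b.tgt))‖ ≤ |B b| * ‖φ‖ := by
    rw [norm_smul, Real.norm_eq_abs]
    refine mul_le_mul_of_nonneg_left ?_ (abs_nonneg _)
    calc ‖C.q (C.U η (A b) (φ b.tgt))‖ ≤ ‖C.U η (A b) (φ b.tgt)‖ := norm_q_apply_le C _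
      _ = ‖φ b.tgt‖ := norm_U_apply C η _ _
      _ ≤ ‖φ‖ := norm_le_pi_norm φ b.tgt
  have h4 : ‖φ b.tgt‖ + ‖φ b.src‖ ≤ 2 * ‖φ‖ := by
    have := norm_le_pi_norm φ b.tgt
    have := norm_le_pi_norm φ b.src
    linarith
  calc |w| * |⟪covDerivScalar c (C.Urep η) A φ b, (B b) • C.q (C.U η (A b) (φ b.tgt))⟫_ℝ|
      ≤ |w| * ((|c| * (2 * ‖φ‖)) * (|B b| * ‖φ‖)) := by
        refine mul_le_mul_of_nonneg_left (h1.trans ?_) (abs_nonneg w)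
        exact mul_le_mul (h2.trans (mul_le_mul_of_nonneg_left h4 (abs_nonneg c))) h3 (norm_nonneg _) (by positivity)
    _ = |w| * (2 * |c| * |B b|) * ‖φ‖ ^ 2 := by ring

/-- the constant `K'(B,λ) = Σ_b |η^d|·3|c|·|ηeB_b|·|(∂^ηλ)(b)|` of `|pairDAdot| ≤ K'·sup|φ|²`. [cite: Balaban1983Higgs3, (2.26) p.431] -/
def dotBound (B : VecField P j ℝ) (lam : Site P j → ℝ) : ℝ :=
  ∑ b : PBond P j, |w| * (3 * |c| * (|η * C.e * B b| * |grad c lam b|))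

/-- `K' ≥ 0`. [cite: Balaban1983Higgs3, (2.26) p.431] -/
theorem dotBound_nonneg (B : VecField P j ℝ) (lam : Site P j → ℝ) : 0 ≤ dotBound C η w c B lam :=
  Finset.sum_nonneg fun _ _ => by positivity

/-- `|pairDAdot(A,B,λ,φ)| ≤ K'(B,λ)·sup|φ|²`, uniformly in the background. [cite: Balaban1983Higgs3, (2.26) p.431] -/
theorem abs_pairDAdot_le (A B : VecField P j ℝ) (lam : Site P j → ℝ) (φ : Cfg P j N) :
    |pairDAdot C η w c A B lam φ| ≤ dotBound C η w c B lam * ‖φ‖ ^ 2 := by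
  unfold pairDAdot dotBound
  rw [Finset.sum_mul]
  refine (Finset.abs_sum_le_sum_abs _ _).trans (Finset.sum_le_sum fun b _ => ?_)
  rw [abs_mul]
  set u := C.U η (A b) (φ b.tgt) with hu
  have hun : ‖u‖ ≤ ‖φ‖ := by rw [hu, norm_U_apply]; exact norm_le_pi_norm φ b.tgt
  have hD : ‖covDerivScalar c (C.Urep η) A φ b‖ ≤ |c| * (2 * ‖φ‖) := by
    refine (norm_covDerivScalar_le C η c A φ b).trans (mul_le_mul_of_nonneg_left ?_ (abs_nonneg c))
    have := norm_le_pi_norm φ b.tgt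
    have := norm_le_pi_norm φ b.src
    linarith
  have hX : ‖(η * C.e * B b) • C.q u‖ ≤ |η * C.e * B b| * ‖φ‖ := by
    rw [norm_smul, Real.norm_eq_abs]
    exact mul_le_mul_of_nonneg_left ((norm_q_apply_le C u).trans hun) (abs_nonneg _)
  have hY : ‖(grad c lam b) • C.q ((η * C.e * B b) • C.q u)‖ ≤ |grad c lam b| * (|η * C.e * B b| * ‖φ‖) := by
    rw [norm_smul, Real.norm_eq_abs]
    exact mul_le_mul_of_nonneg_left ((norm_q_apply_le C _).trans hX) (abs_nonneg _)
  have hZ : ‖(grad c lam b) • C.q u‖ ≤ |grad c lam b| * ‖φ‖ := by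
    rw [norm_smul, Real.norm_eq_abs]
    exact mul_le_mul_of_nonneg_left ((norm_q_apply_le C u).trans hun) (abs_nonneg _)
  have hW : ‖c • ((η * C.e * B b) • C.q u)‖ ≤ |c| * (|η * C.e * B b| * ‖φ‖) := by
    rw [norm_smul, Real.norm_eq_abs]
    exact mul_le_mul_of_nonneg_left hX (abs_nonneg _)
  have i1 := (abs_real_inner_le_norm (covDerivScalar c (C.Urep η) A φ b) ((grad c lam b) • C.q ((η * C.e * B b) • C.q u))).trans
    (mul_le_mul hD hY (norm_nonneg _) (by positivity))
  have i2 := (abs_real_inner_le_norm (c • ((η * C.e * B b) • C.q u)) ((grad c lam b) • C.q u)).trans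
    (mul_le_mul hW hZ (norm_nonneg _) (by positivity))
  calc |w| * |⟪covDerivScalar c (C.Urep η) A φ b, (grad c lam b) • C.q ((η * C.e * B b) • C.q u)⟫_ℝ
        + ⟪c • ((η * C.e * B b) • C.q u), (grad c lam b) • C.q u⟫_ℝ|
      ≤ |w| * (|c| * (2 * ‖φ‖) * (|grad c lam b| * (|η * C.e * B b| * ‖φ‖))
          + |c| * (|η * C.e * B b| * ‖φ‖) * (|grad c lam b| * ‖φ‖)) :=
        mul_le_mul_of_nonneg_left ((abs_add_le _ _).trans (add_le_add i1 i2)) (abs_nonneg w)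
    _ = |w| * (3 * |c| * (|η * C.e * B b| * |grad c lam b|)) * ‖φ‖ ^ 2 := by ring

/-- `φ ↦ ⟨D^η_Aφ, BqU(A)φ⟩` is continuous. [cite: Balaban1983Higgs3, (2.26) p.431] -/
theorem continuous_pairJ (A B : VecField P j ℝ) : Continuous (pairJ C η w c A B : Cfg P j N → ℝ) := by
  unfold pairJ
  refine continuous_finsetSum _ fun b _ => continuous_const.mul ?_
  have hU : Continuous fun φ : Cfg P j N => C.q (C.U η (A b) (φ b.tgt)) :=
    C.q.continuous.comp ((C.U η (A b)).continuous.comp (continuous_apply b.tgt))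
  have h2 : Continuous fun φ : Cfg P j N => (B b) • C.q (C.U η (A b) (φ b.tgt)) := (continuous_const_smul (B b)).comp hU
  exact (continuous_covDerivScalar C η c A b).inner h2

/-- `φ ↦ pairDAdot(A,B,λ,φ)` is continuous. [cite: Balaban1983Higgs3, (2.26) p.431] -/
theorem continuous_pairDAdot (A B : VecField P j ℝ) (lam : Site P j → ℝ) :
    Continuous (pairDAdot C η w c A B lam : Cfg P j N → ℝ) := by
  unfold pairDAdot
  refine continuous_finsetSum _ fun b _ => continuous_const.mul ?_
  have hU : Continuous fun φ : Cfg P j N => C.q (C.U η (A b) (φ b.tgt)) :=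
    C.q.continuous.comp ((C.U η (A b)).continuous.comp (continuous_apply b.tgt))
  have hX : Continuous fun φ : Cfg P j N => (η * C.e * B b) • C.q (C.U η (A b) (φ b.tgt)) :=
    (continuous_const_smul (η * C.e * B b)).comp hU
  have hY : Continuous fun φ : Cfg P j N => (grad c lam b) • C.q ((η * C.e * B b) • C.q (C.U η (A b) (φ b.tgt))) :=
    (continuous_const_smul (grad c lam b)).comp (C.q.continuous.comp hX)
  have hZ : Continuous fun φ : Cfg P j N => (grad c lam b) • C.q (C.U η (A b) (φ b.tgt)) :=
    (continuous_const_smul (grad c lam b)).comp hU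
  have hW : Continuous fun φ : Cfg P j N => c • ((η * C.e * B b) • C.q (C.U η (A b) (φ b.tgt))) :=
    (continuous_const_smul c).comp hX
  exact ((continuous_covDerivScalar C η c A b).inner hY).add (hW.inner hZ)

end Literature.MathematicalPhysics.QuantumFieldTheory.Balaban1983to89.B3WT226Pairings

end
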